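import Summits.QuantumFields.BalabanUV.T4Continuum.Support.NE7SliceIterationOrbitWeightedNL0
import HarnessLib

/-!
# [(R1″) FRAME-FREE PORT — memo ROAD-G103 §6: VERBATIM `NE7SliceOrbitNL` with row NE3's `rightInvW` replaced by `NE7FrameFreeRightInverse.rightInvW0` (`dirIter R₀ = id`, `framePotW R₀ = 0` exactly),
# constants `supC ↦ supC0`, `supCurlC ↦ supCurlC0`, one extra def-parameter `hE`; right-inverse-independent lemmas are imported from `NE7SliceOrbitNL` BY NAME, not restated.]
# NE7SliceOrbitNL0 — THE (S1) ORBIT THEOREM ON THE NONLINEAR FRAME TARGET (memo ROAD-G103 §3, (R1′), file (B2)-6): `NE7SliceIterationOrbitWeighted.slice_orbit_w` VERBATIM with `Df ↦ D̃f`, the step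
# `u ↦ e^{−ζ̃(u)}u`, the currency `τ + ω` (`ω ≥ 4C_Γ·M·b₁`) in the two contraction lines, the radius line `2S + 6M·δmax ≤ M·b₁`, and B7's Prop-4 regime for `W`, `U′` at `b₁` displayed — the Cauchy
# engine `NE7DefectIterationCauchy.exists_orbit_limit` fed with `NE7SliceIterationOrbitWeightedNL0.step_halves_defect_w_nl` ∕ `step_sizes_le_w_nl`

Cell `pub-balaban`, rung (B)+1 sub-cell t4, lineage `b2b-balaban-t4-ne7-p1`, generation 103 (CRUX PROVER NE7 #1 = OWNER of BINDER row NE7).  Memo `t4/b2b-balaban-t4-ne7-p1-g103/ROAD-G103.md` §3.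
WHAT ([folklore]; 0 def, 0 sorry).  **`slice_orbit_w_nl`** (statement displayed; its outputs are the binders of NE7b's `NE7SliceLimitNL.limitNL_of_geometric`).
HONEST FRAMING (page 1): the engine run on OUR state maps; nothing of Bałaban's asserted; NOT the initial state, NOT the slice condition of the limit, NOT NE7; spine 0∕9; finite T⁴ rung (B)+1 — NOT infinite
volume, NOT mass gap, NOT BetaPertH, NOT Clay (continuum YM on T⁴ ⇐ BetaPertH ∧ nine spine estimates, 0/9 proved).
-/

set_option autoImplicit false

open scoped BigOperators Matrix.Norms.L2Operator
open NormedSpace Finset Filter Topology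

namespace Summit.QuantumFields.BalabanUV.T4Continuum.NE7SliceOrbitNL0

open Literature.MathematicalPhysics.QuantumFieldTheory.Balaban1983to89
open B7Prop1Explicit B7Prop2Explicit B7Prop3Flat MatrixLog
open T4AveragingDeficitWall (IsUnitaryCfg IsSkewDir SmallField vary curlAt)
open T4AveragingDeficitWallBoundary (IsPeriodicCfg periodBox)
open AveragingDeficitPeriodicCounting (IsPeriodicDir)
open AveragingDeficitTwoLevelPrep (prop1Radius)
open AveragingDeficitMultiLevelPrep (cavgIter LevelSmall tower)
open BlockAveragePushDirGauge (gaugeDir)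
open NE3EnergyShapes (IsUnitarySite IsPeriodicSite)
open NE3RightInverseSupLetters (frameC supC)
open NE3HatInvCurlLetters (supCurlC)
open NE7FrameFreeRightInverse (rightInvW0 supC0 supCurlC0 supC0_nonneg norm_rightInvW0_le norm_curlAt_rightInvW0_le)
open NE3QbarIterCovLiftPrep (cruxC)
open NE3LinearisedAverageSup (curvSum)
open NE7MeanZeroGaugeSliceW (energyBlockLandauW)
open NE7DefectIterationCauchy (exists_orbit_limit mem_unitary_of_tendsto periodic_of_tendsto)
open SpreadLift (loopRad)
open NE7SliceIterationState (repLog cornerLog sizePair siteSup_le siteSup_nonneg bondSup_le bondSup_nonneg)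
open NE7SliceIterationStateNL0
open NE7SliceIterationStateNL (frameDefect effCornerLog coarseDatumNL coarseDatumNL_eq effCornerLog_add_frameDefect)
open NE7SliceIterationStateFactsNL0
open NE7SliceIterationStateFactsNL (relPert_repLog_eq relPert_repLog_mem_unitary relPert_repLog_periodic pdev_relPert_mul_le frameDefect_skew frameDefect_periodic
  norm_frameDefect_le effCornerLog_skew effCornerLog_periodic norm_effCornerLog_le coarseDatumNL_skew_periodic)
open NE7SliceIterationStepNL0
open NE7SliceIterationStepNL (norm_expUnit_neg_mul_sub_le norm_repLog_le_radius radius_nonneg)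
open NE7SliceIterationOrbit (region_sizes)
open NE7SliceIterationOrbitWeighted (weighted_region)
open NE7SliceIterationOrbitWeightedNL0 (step_halves_defect_w_nl step_sizes_le_w_nl)

noncomputable section

variable {d : ℕ} {n : Type*} [Fintype n] [DecidableEq n]

section Orbit

variable [Nonempty n] {L : ℕ} (hL : 2 ≤ L) (k : ℕ) {W : Site d → Fin d → (Matrix n n ℂ)ˣ} {x : ℝ} (hWu : IsUnitaryCfg W) (hx : 0 ≤ x) (hs : LevelSmall d L k x)
  (hWx : SmallField W x) (N : ℕ) [NeZero N] (hθ : cruxC d L * (((L : ℝ) ^ (k + 1)) ^ 2 * x) < 1)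
  (hE : 4 * (d : ℝ) ^ 2 * ((L : ℝ) ^ (k + 1) - 1) ^ 2 * x + 16 * d * loopRad d L ((prop1Radius d L)^[k] x) ≤ 1 / 2) (U' : Site d → Fin d → (Matrix n n ℂ)ˣ)
  (hWP : IsPeriodicCfg W ((tower L N (k + 1) : ℕ) : ℤ)) (hU'u : IsUnitaryCfg U') (hU'P : IsPeriodicCfg U' ((tower L N (k + 1) : ℕ) : ℤ))
  (hd : 1 ≤ d) (κ₀ : Fin d) {α₀ αP x' b₁ ω : ℝ} (hα : 0 < α₀) (hα3 : C0 d * α₀ ≤ 1 / 3) (hα4 : 4 * α₀ ≤ c2' d L) (h52 : pdev W < α₀ * (((L : ℝ) ^ (k + 1))⁻¹) ^ 2)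
  (hsmall : Real.exp (4 * (800 * ((d : ℝ) + 1) ^ 2 * ((d : ℝ) + 4)) * α₀) * (1 + 8 * (131072 * ((d : ℝ) + 1) ^ 2) * ((L : ℝ) ^ (k + 1) * b₁)) ≤ 2)
  (hc₃ : 2 * ((L : ℝ) ^ (k + 1) * b₁) ≤ c3 d L) (h100 : 100 * ((d : ℝ) * L * ((L : ℝ) ^ (k + 1) * b₁)) ≤ 1)
  (hC16 : 16 * (131072 * ((d : ℝ) + 1) ^ 2) * ((L : ℝ) ^ (k + 1) * b₁) ≤ 1) (hsm : 2048 * (d : ℝ) * ((L : ℝ) ^ (k + 1) * b₁) ≤ 1)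
  (hαP : 0 < αP) (hαP3 : C0 d * αP ≤ 1 / 3) (hαP2 : 2 * αP ≤ c2' d L) (hx'0 : 0 ≤ x') (hU'x : SmallField U' x') (hx'P : x' < αP * (((L : ℝ) ^ (k + 1))⁻¹) ^ 2)
  (hω0 : 0 ≤ ω) (hβ : 4 * (56 * ((d : ℝ) * L) ^ 2 + 16 * (131072 * ((d : ℝ) + 1) ^ 2) * ((d : ℝ) * L)) * ((L : ℝ) ^ (k + 1) * b₁) ≤ ω)

/-! ## §2 The orbit and its limit on the nonlinear target (k-uniform regime) -/

include hWP hU'u hU'P hd κ₀ hα hα3 hα4 h52 hsmall hc₃ h100 hC16 hsm hαP hαP3 hαP2 hx'0 hU'x hx'P hω0 hβ in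
/-- **THE (S1) ORBIT ON THE NONLINEAR FRAME TARGET CONVERGES, k-UNIFORM REGIME** — `NE7SliceIterationOrbitWeighted.slice_orbit_w` with `Df ↦ D̃f`, the step `u ↦ e^{−ζ̃(u)}u`, the two lines
`τ + ω ≤ 1`, `3·10⁶(1+16K)(1+d)³(1+frameC)(1+supC+supCurlC)·(τ + ω) ≤ 1∕2` (`ω ≥ 4C_Γ·M·b₁`), the radius line `2S + 6M·δmax ≤ M·b₁`, and B7's Prop-4 regime for `W`, `U′` at `b₁` displayed:
from `u₀` on the working region with weighted sizes `≤ s₀`, `D̃f(u₀) ≤ δ₀ ≤ δmax`, `s₀ + 24dM·δ₀ ≤ S`, the orbit stays on the region, `D̃f(u_j) ≤ 2^{−j}δ₀`, weighted sizes `≤ s₀ + 24dM·δ₀`, and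
converges sitewise to a unitary `(tower)`-periodic `u⋆` at rate `24dM·δ₀·2^{−j}`. [folklore] -/
theorem slice_orbit_w_nl
    (hθP : 4 * (d : ℝ) ^ 2 * ((L : ℝ) ^ (k + 1) - 1) ^ 2 * x + 16 * d * loopRad d L ((prop1Radius d L)^[k] x)
      + 4 * d * ((d : ℝ) - 1) * ((L : ℝ) ^ (k + 1) - 1) ^ 2 * x ≤ 1 / 2)
    {K : ℝ} (hK : 0 ≤ K) (hKε : 16 * K * d * (((L : ℝ) ^ (k + 1)) ^ 2 * x) ≤ 1 / 2)
    (hLet : ∀ Y : Site d → Fin d → Matrix n n ℂ, Y ∈ energyBlockLandauW (d := d) (n := n) L N (k + 1) W →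
      ∀ B : ℝ, (∀ (z : Site d) (μ ν : Fin d), μ ≠ ν → ‖curlAt W Y z μ ν‖ ≤ B) → ∀ (y : Site d) (κ : Fin d), ‖Y y κ‖ ≤ K * (L : ℝ) ^ (k + 1) * B)
    (hε : ((L : ℝ) ^ (k + 1)) ^ 2 * x ≤ 1) (hA : curvSum d L (k + 1) x ≤ 2 / 3 * L) (hθc : cruxC d L * (((L : ℝ) ^ (k + 1)) ^ 2 * x) ≤ 1 / 2)
    {τ S δmax : ℝ} (hτ0 : 0 ≤ τ) (hτ1 : τ + ω ≤ 1) (hτs : 30000 * (d : ℝ) * τ ≤ 1)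
    (hC : 3000000 * (1 + 16 * K) * (1 + (d : ℝ)) ^ 3 * (1 + frameC d L) * (1 + supC0 d L + supCurlC0 d L) * (τ + ω) ≤ 1 / 2)
    (hS4 : S ≤ 1 / 10000) (hSτ : S ≤ τ)
    (hδmax : 6 * (d : ℝ) * (L : ℝ) ^ (k + 1) * δmax ≤ 1 / 10000) (hMδ : (L : ℝ) ^ (k + 1) * δmax ≤ τ)
    (h4 : ((L : ℝ) ^ (k + 1)) ^ 2 * x ≤ τ) (h5 : ((L : ℝ) ^ (k + 1)) ^ 2 * x' ≤ τ) (hSb : 2 * S + 6 * ((L : ℝ) ^ (k + 1) * δmax) ≤ (L : ℝ) ^ (k + 1) * b₁)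
    {u₀ : Site d → (Matrix n n ℂ)ˣ} (hu₀ : IsUnitarySite u₀) (hu₀P : IsPeriodicSite u₀ ((tower L N (k + 1) : ℕ) : ℤ))
    (hgauge₀ : gaugeAct u₀ U' = vary W (repLog W U' u₀) 1)
    (hcorner₀ : ∀ z, ((u₀ (((L : ℤ) ^ (k + 1)) • z) : (Matrix n n ℂ)ˣ) : Matrix n n ℂ) = exp (cornerLog L k u₀ z))
    {s₀ δ₀ : ℝ} (hδ₀ : 0 ≤ δ₀) (hδ₀max : δ₀ ≤ δmax)
    (hs₀ : ‖((L : ℝ) ^ (k + 1) * (sizePair (L := L) (W := W) k N U' u₀).1, (sizePair (L := L) (W := W) k N U' u₀).2)‖ ≤ s₀)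
    (hd₀ : sliceDefectNL0 hL k hWu hx hs hWx N hθ hE U' u₀ ≤ δ₀)
    (hSsum : s₀ + 12 * d * (L : ℝ) ^ (k + 1) * δ₀ / (1 - 1 / 2) ≤ S) :
    ∃ ustar : Site d → (Matrix n n ℂ)ˣ, IsUnitarySite ustar ∧ IsPeriodicSite ustar ((tower L N (k + 1) : ℕ) : ℤ) ∧
      (∀ y, Tendsto (fun j => (((sliceStepNL0 hL k hWu hx hs hWx N hθ hE U')^[j] u₀ y : (Matrix n n ℂ)ˣ) : Matrix n n ℂ)) atTop (𝓝 ((ustar y : (Matrix n n ℂ)ˣ) : Matrix n n ℂ))) ∧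
      (∀ (y : Site d) (j : ℕ), ‖(((sliceStepNL0 hL k hWu hx hs hWx N hθ hE U')^[j] u₀ y : (Matrix n n ℂ)ˣ) : Matrix n n ℂ) - ((ustar y : (Matrix n n ℂ)ˣ) : Matrix n n ℂ)‖
        ≤ 12 * d * (L : ℝ) ^ (k + 1) * δ₀ * (1 / 2) ^ j / (1 - 1 / 2)) ∧
      ∀ j, (IsUnitarySite ((sliceStepNL0 hL k hWu hx hs hWx N hθ hE U')^[j] u₀) ∧ IsPeriodicSite ((sliceStepNL0 hL k hWu hx hs hWx N hθ hE U')^[j] u₀) ((tower L N (k + 1) : ℕ) : ℤ) ∧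
          gaugeAct ((sliceStepNL0 hL k hWu hx hs hWx N hθ hE U')^[j] u₀) U' = vary W (repLog W U' ((sliceStepNL0 hL k hWu hx hs hWx N hθ hE U')^[j] u₀)) 1 ∧
          (∀ z, ((((sliceStepNL0 hL k hWu hx hs hWx N hθ hE U')^[j] u₀) (((L : ℤ) ^ (k + 1)) • z) : (Matrix n n ℂ)ˣ) : Matrix n n ℂ)
            = exp (cornerLog L k ((sliceStepNL0 hL k hWu hx hs hWx N hθ hE U')^[j] u₀) z)) ∧
          sliceDefectNL0 hL k hWu hx hs hWx N hθ hE U' ((sliceStepNL0 hL k hWu hx hs hWx N hθ hE U')^[j] u₀) ≤ δmax) ∧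
        sliceDefectNL0 hL k hWu hx hs hWx N hθ hE U' ((sliceStepNL0 hL k hWu hx hs hWx N hθ hE U')^[j] u₀) ≤ (1 / 2) ^ j * δ₀ ∧
        ‖((L : ℝ) ^ (k + 1) * (sizePair (L := L) (W := W) k N U' ((sliceStepNL0 hL k hWu hx hs hWx N hθ hE U')^[j] u₀)).1,
            (sizePair (L := L) (W := W) k N U' ((sliceStepNL0 hL k hWu hx hs hWx N hθ hE U')^[j] u₀)).2)‖
          ≤ s₀ + 12 * d * (L : ℝ) ^ (k + 1) * δ₀ / (1 - 1 / 2) := by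
  have hM0 : 0 < (L : ℝ) ^ (k + 1) := by positivity
  have hM1 : (1 : ℝ) ≤ (L : ℝ) ^ (k + 1) := one_le_pow₀ (by exact_mod_cast (by omega : 1 ≤ L))
  have hreg : ∀ u : Site d → (Matrix n n ℂ)ˣ, IsPeriodicSite u ((tower L N (k + 1) : ℕ) : ℤ) →
      ‖((L : ℝ) ^ (k + 1) * (sizePair (L := L) (W := W) k N U' u).1, (sizePair (L := L) (W := W) k N U' u).2)‖ ≤ S →
      (L : ℝ) ^ (k + 1) * (sizePair (L := L) (W := W) k N U' u).1 ≤ S ∧ (sizePair (L := L) (W := W) k N U' u).2 ≤ S ∧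
      (∀ y κ, ‖repLog W U' u y κ‖ ≤ S) ∧ (∀ z, ‖cornerLog L k u z‖ ≤ S) ∧ (∀ y κ, ‖repLog W U' u y κ‖ ≤ b₁) := fun u huP hΦ => by
    obtain ⟨hX, hh, h10, -, -, -⟩ := region_sizes hL k N U' hWP hU'P huP
    obtain ⟨h1, h1', h2⟩ := weighted_region hL k N U' hΦ
    have hδmax0 : 0 ≤ (L : ℝ) ^ (k + 1) * δmax := mul_nonneg hM0.le (hδ₀.trans hδ₀max)
    have hSb' : (sizePair (L := L) (W := W) k N U' u).1 ≤ b₁ := by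
      have e1 : (L : ℝ) ^ (k + 1) * (sizePair (L := L) (W := W) k N U' u).1 ≤ (L : ℝ) ^ (k + 1) * b₁ := by
        linarith only [h1, hSb, hδmax0, h10.trans h1']
      exact le_of_mul_le_mul_left e1 hM0
    exact ⟨h1, h2, fun y κ => (hX y κ).trans h1', fun z => (hh z).trans h2, fun y κ => (hX y κ).trans hSb'⟩
  have hb₁0 : 0 ≤ b₁ := by
    obtain ⟨-, -, -, -, hXb⟩ := hreg u₀ hu₀P (hs₀.trans (by
      have : 0 ≤ 12 * (d : ℝ) * (L : ℝ) ^ (k + 1) * δ₀ / (1 - 1 / 2) := by positivity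
      linarith only [hSsum, this]))
    exact (norm_nonneg _).trans (hXb 0 κ₀)
  have hgf : ∀ u : Site d → (Matrix n n ℂ)ˣ, IsUnitarySite u → IsPeriodicSite u ((tower L N (k + 1) : ℕ) : ℤ) → gaugeAct u U' = vary W (repLog W U' u) 1 →
      (∀ z, ((u (((L : ℤ) ^ (k + 1)) • z) : (Matrix n n ℂ)ˣ) : Matrix n n ℂ) = exp (cornerLog L k u z)) → sliceDefectNL0 hL k hWu hx hs hWx N hθ hE U' u ≤ δmax →
      ‖((L : ℝ) ^ (k + 1) * (sizePair (L := L) (W := W) k N U' u).1, (sizePair (L := L) (W := W) k N U' u).2)‖ ≤ S →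
      (∀ y, ‖gaugeFunNL0 hL k hWu hx hs hWx N hθ hE U' u y‖ ≤ 6 * d * (L : ℝ) ^ (k + 1) * sliceDefectNL0 hL k hWu hx hs hWx N hθ hE U' u) ∧
        6 * (d : ℝ) * (L : ℝ) ^ (k + 1) * sliceDefectNL0 hL k hWu hx hs hWx N hθ hE U' u ≤ 1 / 10000 := fun u hu huP hgauge hcorner hDf hΦ => by
    obtain ⟨-, -, hXs, hhs, hXb⟩ := hreg u huP hΦ
    have hX8 : ∀ y κ, ‖repLog W U' u y κ‖ ≤ 1 / 8 := fun y κ => (hXs y κ).trans (by linarith only [hS4])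
    have hh8 : ∀ z, ‖cornerLog L k u z‖ ≤ 1 / 8 := fun z => (hhs z).trans (by linarith only [hS4])
    exact ⟨norm_gaugeFunNL0_le hL k hWu hx hs hWx N hθ hE U' hWP hU'u hU'P hu huP hgauge hX8 hcorner hh8 hd hα hα3 hα4 h52 hb₁0 hXb hsmall hc₃ hsm hαP hαP3 hαP2 hx'0 hU'x hx'P hθP,
      (mul_le_mul_of_nonneg_left hDf (by positivity)).trans hδmax⟩
  have hS2 : S ≤ 1 / 100 := hS4.trans (by norm_num)
  have hmaps : ∀ u ∈ {u : Site d → (Matrix n n ℂ)ˣ | IsUnitarySite u ∧ IsPeriodicSite u ((tower L N (k + 1) : ℕ) : ℤ) ∧ gaugeAct u U' = vary W (repLog W U' u) 1 ∧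
      (∀ z, ((u (((L : ℤ) ^ (k + 1)) • z) : (Matrix n n ℂ)ˣ) : Matrix n n ℂ) = exp (cornerLog L k u z)) ∧ sliceDefectNL0 hL k hWu hx hs hWx N hθ hE U' u ≤ δmax},
      ‖((L : ℝ) ^ (k + 1) * (sizePair (L := L) (W := W) k N U' u).1, (sizePair (L := L) (W := W) k N U' u).2)‖ ≤ S → sliceStepNL0 hL k hWu hx hs hWx N hθ hE U' u ∈ {u : Site d → (Matrix n n ℂ)ˣ | IsUnitarySite u ∧ IsPeriodicSite u ((tower L N (k + 1) : ℕ) : ℤ) ∧ gaugeAct u U' = vary W (repLog W U' u) 1 ∧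
      (∀ z, ((u (((L : ℤ) ^ (k + 1)) • z) : (Matrix n n ℂ)ˣ) : Matrix n n ℂ) = exp (cornerLog L k u z)) ∧ sliceDefectNL0 hL k hWu hx hs hWx N hθ hE U' u ≤ δmax} := by
    rintro u ⟨hu, huP, hgauge, hcorner, hDf⟩ hΦ
    obtain ⟨hΦ1, hΦ2, hXs, hhs, hXb⟩ := hreg u huP hΦ
    obtain ⟨hσ, hσ4⟩ := hgf u hu huP hgauge hcorner hDf hΦ
    have hhalf := step_halves_defect_w_nl hL k hWu hx hs hWx N hθ hE U' hWP hU'u hU'P hd κ₀ hα hα3 hα4 h52 hsmall hc₃ h100 hC16 hsm hαP hαP3 hαP2 hx'0 hU'x hx'P hω0 hβ hθP hK hKε hLet hε hA hθc hτ0 hτ1 hτs hC hS4 hSτ hδmax hMδ h4 h5 hSb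
      hu huP hgauge hcorner hDf hΦ1 hΦ2
    have hDf0 := sliceDefectNL0_nonneg hL k hWu hx hs hWx N hθ hE U' u
    have hX8 : ∀ y κ, ‖repLog W U' u y κ‖ ≤ 1 / 8 := fun y κ => (hXs y κ).trans (by linarith only [hS4])
    have hh8 : ∀ z, ‖cornerLog L k u z‖ ≤ 1 / 8 := fun z => (hhs z).trans (by linarith only [hS4])
    have hDf0' : (0 : ℝ) ≤ 0 := le_rfl
    refine ⟨?_, ?_, sliceStepNL0_chart hL k hWu hx hs hWx N hθ hE U' hgauge hXs hS4 hσ hσ4, sliceStepNL0_corner hL k hWu hx hs hWx N hθ hE U' hcorner hhs hS2 hσ hσ4, hhalf.trans (by linarith only [hDf, hDf0])⟩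
    · have hζs := (splitNL0_holds hL k hWu hx hs hWx N hθ hE U' hWP hU'u hU'P hu huP hgauge hX8 hcorner hh8 hd hα hα3 hα4 h52 hb₁0 hXb hsmall hc₃ hsm hαP hαP3 hαP2 hx'0 hU'x hx'P).1
      intro y
      rw [sliceStepNL0_apply]
      refine (unitaryUnits _).mul_mem ?_ (hu y)
      rw [mem_unitaryUnits, val_expUnit]
      letI : NormedAlgebra ℚ (Matrix n n ℂ) := NormedAlgebra.restrictScalars ℚ ℂ (Matrix n n ℂ)
      exact NormedSpace.exp_mem_unitary_of_mem_skewAdjoint ((skewAdjoint _).neg_mem (hζs y))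
    · have hζP := (splitNL0_holds hL k hWu hx hs hWx N hθ hE U' hWP hU'u hU'P hu huP hgauge hX8 hcorner hh8 hd hα hα3 hα4 h52 hb₁0 hXb hsmall hc₃ hsm hαP hαP3 hαP2 hx'0 hU'x hx'P).2.1
      intro y i
      rw [sliceStepNL0_apply, sliceStepNL0_apply, hζP y i, huP y i]
  have hcontr : ∀ u ∈ {u : Site d → (Matrix n n ℂ)ˣ | IsUnitarySite u ∧ IsPeriodicSite u ((tower L N (k + 1) : ℕ) : ℤ) ∧ gaugeAct u U' = vary W (repLog W U' u) 1 ∧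
      (∀ z, ((u (((L : ℤ) ^ (k + 1)) • z) : (Matrix n n ℂ)ˣ) : Matrix n n ℂ) = exp (cornerLog L k u z)) ∧ sliceDefectNL0 hL k hWu hx hs hWx N hθ hE U' u ≤ δmax},
      ‖((L : ℝ) ^ (k + 1) * (sizePair (L := L) (W := W) k N U' u).1, (sizePair (L := L) (W := W) k N U' u).2)‖ ≤ S →
      sliceDefectNL0 hL k hWu hx hs hWx N hθ hE U' (sliceStepNL0 hL k hWu hx hs hWx N hθ hE U' u) ≤ 1 / 2 * sliceDefectNL0 hL k hWu hx hs hWx N hθ hE U' u := by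
    rintro u ⟨hu, huP, hgauge, hcorner, hDf⟩ hΦ
    obtain ⟨hΦ1, hΦ2, -, -, -⟩ := hreg u huP hΦ
    have hhalf := step_halves_defect_w_nl hL k hWu hx hs hWx N hθ hE U' hWP hU'u hU'P hd κ₀ hα hα3 hα4 h52 hsmall hc₃ h100 hC16 hsm hαP hαP3 hαP2 hx'0 hU'x hx'P hω0 hβ hθP hK hKε hLet hε hA hθc hτ0 hτ1 hτs hC hS4 hSτ hδmax hMδ h4 h5 hSb
      hu huP hgauge hcorner hDf hΦ1 hΦ2
    linarith only [hhalf]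
  have hgrow : ∀ u ∈ {u : Site d → (Matrix n n ℂ)ˣ | IsUnitarySite u ∧ IsPeriodicSite u ((tower L N (k + 1) : ℕ) : ℤ) ∧ gaugeAct u U' = vary W (repLog W U' u) 1 ∧
      (∀ z, ((u (((L : ℤ) ^ (k + 1)) • z) : (Matrix n n ℂ)ˣ) : Matrix n n ℂ) = exp (cornerLog L k u z)) ∧ sliceDefectNL0 hL k hWu hx hs hWx N hθ hE U' u ≤ δmax},
      ‖((L : ℝ) ^ (k + 1) * (sizePair (L := L) (W := W) k N U' u).1, (sizePair (L := L) (W := W) k N U' u).2)‖ ≤ S →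
      ‖((L : ℝ) ^ (k + 1) * (sizePair (L := L) (W := W) k N U' (sliceStepNL0 hL k hWu hx hs hWx N hθ hE U' u)).1,
          (sizePair (L := L) (W := W) k N U' (sliceStepNL0 hL k hWu hx hs hWx N hθ hE U' u)).2)‖
        ≤ ‖((L : ℝ) ^ (k + 1) * (sizePair (L := L) (W := W) k N U' u).1, (sizePair (L := L) (W := W) k N U' u).2)‖
          + 12 * d * (L : ℝ) ^ (k + 1) * sliceDefectNL0 hL k hWu hx hs hWx N hθ hE U' u := by
    rintro u ⟨hu, huP, hgauge, hcorner, hDf⟩ hΦ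
    obtain ⟨hΦ1, hΦ2, -, -, -⟩ := hreg u huP hΦ
    exact step_sizes_le_w_nl hL k hWu hx hs hWx N hθ hE U' hWP hU'u hU'P hd hα hα3 hα4 h52 hsmall hc₃ hsm hαP hαP3 hαP2 hx'0 hU'x hx'P hθP hτs hS4 hSτ hδmax hSb
      hu huP hgauge hcorner hDf hΦ1 hΦ2
  have hdisp : ∀ u ∈ {u : Site d → (Matrix n n ℂ)ˣ | IsUnitarySite u ∧ IsPeriodicSite u ((tower L N (k + 1) : ℕ) : ℤ) ∧ gaugeAct u U' = vary W (repLog W U' u) 1 ∧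
      (∀ z, ((u (((L : ℤ) ^ (k + 1)) • z) : (Matrix n n ℂ)ˣ) : Matrix n n ℂ) = exp (cornerLog L k u z)) ∧ sliceDefectNL0 hL k hWu hx hs hWx N hθ hE U' u ≤ δmax},
      ‖((L : ℝ) ^ (k + 1) * (sizePair (L := L) (W := W) k N U' u).1, (sizePair (L := L) (W := W) k N U' u).2)‖ ≤ S →
      ∀ y : Site d, ‖((sliceStepNL0 hL k hWu hx hs hWx N hθ hE U' u y : (Matrix n n ℂ)ˣ) : Matrix n n ℂ) - ((u y : (Matrix n n ℂ)ˣ) : Matrix n n ℂ)‖ ≤ 12 * d * (L : ℝ) ^ (k + 1) * sliceDefectNL0 hL k hWu hx hs hWx N hθ hE U' u := by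
    rintro u ⟨hu, huP, hgauge, hcorner, hDf⟩ hΦ y
    obtain ⟨hσ, hσ4⟩ := hgf u hu huP hgauge hcorner hDf hΦ
    have h := norm_expUnit_neg_mul_sub_le (hu y) (hσ y) hσ4
    rw [← sliceStepNL0_apply hL k hWu hx hs hWx N hθ hE U' u y] at h
    have hDf0 := sliceDefectNL0_nonneg hL k hWu hx hs hWx N hθ hE U' u
    have hd0 : (0 : ℝ) ≤ d := by positivity
    linarith only [h, mul_nonneg (mul_nonneg hd0 hM0.le) hDf0]
  obtain ⟨v, hv, htail, horbit⟩ := exists_orbit_limit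
    (K := {u : Site d → (Matrix n n ℂ)ˣ | IsUnitarySite u ∧ IsPeriodicSite u ((tower L N (k + 1) : ℕ) : ℤ) ∧ gaugeAct u U' = vary W (repLog W U' u) 1 ∧
      (∀ z, ((u (((L : ℤ) ^ (k + 1)) • z) : (Matrix n n ℂ)ˣ) : Matrix n n ℂ) = exp (cornerLog L k u z)) ∧ sliceDefectNL0 hL k hWu hx hs hWx N hθ hE U' u ≤ δmax})
    (step := sliceStepNL0 hL k hWu hx hs hWx N hθ hE U')
    (Φ := fun u => ((L : ℝ) ^ (k + 1) * (sizePair (L := L) (W := W) k N U' u).1, (sizePair (L := L) (W := W) k N U' u).2))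
    (Df := sliceDefectNL0 hL k hWu hx hs hWx N hθ hE U')
    (ev := fun (u : Site d → (Matrix n n ℂ)ˣ) (y : Site d) => ((u y : (Matrix n n ℂ)ˣ) : Matrix n n ℂ))
    (θ := 1 / 2) (A := 12 * d * (L : ℝ) ^ (k + 1)) (B := 12 * d * (L : ℝ) ^ (k + 1)) (S := S) (s₀ := s₀) (δ₀ := δ₀) (u₀ := u₀)
    (by norm_num) (by norm_num) (by positivity) hδ₀ hSsum hmaps hcontr hgrow (by positivity) hdisp ⟨hu₀, hu₀P, hgauge₀, hcorner₀, hd₀.trans hδ₀max⟩ hs₀ hd₀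
  have hvu : ∀ y, v y ∈ unitary (Matrix n n ℂ) := mem_unitary_of_tendsto (fun j => (horbit j).1.1) hv
  refine ⟨fun y => Unitary.toUnits ⟨v y, hvu y⟩, fun y => mem_unitaryUnits.mpr (hvu y), fun y i => ?_, fun y => hv y, fun y j => ?_,
    fun j => ⟨(horbit j).1, (horbit j).2.1, (horbit j).2.2⟩⟩
  · exact Units.ext (periodic_of_tendsto (fun j => (horbit j).1.2.1) hv y i)
  · have h := htail y j
    rwa [dist_eq_norm] at h

end Orbit

end

end Summit.QuantumFields.BalabanUV.T4Continuum.NE7SliceOrbitNL0
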